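import Summits.ResolutionOfSingularities.ResolutionOfSingularities.Theorems.PAlterationPicoverRegularIffNormalFormZero
import Summits.ResolutionOfSingularities.ResolutionOfSingularities.Theorems.PAlterationPicoverIntegralClosureStalk
import Summits.ResolutionOfSingularities.ResolutionOfSingularities.Theorems.PAlterationPicoverStalkNormalizationIn
import Literature.AlgebraicGeometry.Resolution.RegularLocalRingsProofs
import Literature.AlgebraicGeometry.Resolution.RegularLocalRingsNormal
import HarnessLib

set_option linter.dupNamespace false -- mandated namespace of this single-conjunct summit

/-!
# The regular locus of the degree-`p` radicial normalization, read through Giraud normal forms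

Crux `Picover` (stmt-ResolutionOfSingularities-0554), line `giraud-separated-base`, stub
`isRegularLocalRing_stalk_iff_exists_giraudNormalFormAt_zero` — the scheme-level bridge between
the two lines of the crux.

**Setting.** `k` a field of characteristic `p`, `W` an integral scheme locally of finite type over
`k`, `L ⊇ K(W)` purely inseparable of degree `p`, `W^L = normalizationIn W L` with structure map
`ι : W^L → W`, `x ∈ W^L` over a point `w = ι x` whose local ring `O = 𝒪_{W,w}` is regular.

**Claim.** `𝒪_{W^L,x}` is regular iff some representative `b ∈ O` of the class of `L`
(`L = K(W)(b^{1/p})`, i.e. `b` has a `p`-th root `y ∈ L ∖ K(W)`) is in Giraud normal form with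
respect to the EMPTY family of boundary equations.

**Proof.** `O` is an integrally closed domain (Matsumura 19.4), so by the glue lemma A2
(`StalkNormalizationIn.nonempty_stalk_normalizationIn_iso_of_isPurelyInseparable`) the stalk
`𝒪_{W^L,x}` is ring-isomorphic to `S = integralClosure O L`, which by
`IntegralClosureStalk.integralClosure_stalk_radicial` is a finite, faithful, integrally closed
`O`-algebra of rank `p` with `S^p ⊆ O`.  Regularity is transported along the isomorphism
(`S` regular local ⟹ `S` regular by Serre's Thm. 19.3; conversely `S` is local, being isomorphic
to a stalk), and the abstract criterion
`RegularIffNormalFormZero.isRegularRing_iff_exists_giraudNormalFormAt_zero` identifies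
regularity of `S` with the existence of `h ∈ O`, `s ∈ S ∖ O` with `s^p = h` in boundary-free
Giraud normal form.  Finally `s ∈ S ∖ O` with `s^p = h` is the same as `y = s ∈ L ∖ K(W)` with
`y^p = h`: a `p`-th root of an element of `O` is integral, and an element of `K(W)` integral over
the integrally closed `O` lies in `O`.
-/

noncomputable section

open CategoryTheory AlgebraicGeometry Literature.AlgebraicGeometry.Resolution

namespace Summit.ResolutionOfSingularities.ResolutionOfSingularities.Theorems.Picover.RegularLocusNormalForm

/-- **Root bookkeeping.** For an integrally closed domain `O` with fraction field `K`, a field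
`L ⊇ K` made into an `O`-algebra through `K`, `S = integralClosure O L`, `b ∈ O` and `0 < n`:
`b` has an `n`-th root in `S ∖ O` iff it has an `n`-th root in `L ∖ K` (an `n`-th root of an
element of `O` is integral over `O`; an element of `K` integral over `O` lies in `O`). -/
private theorem exists_root_integralClosure_iff {O K L : Type*} [CommRing O] [Field K]
    [Algebra O K] [IsFractionRing O K] [IsIntegrallyClosed O] [Field L] [Algebra K L]
    [Algebra O L] [IsScalarTower O K L] {n : ℕ} (hn : 0 < n) (b : O) :
    (∃ s : integralClosure O L, s ^ n = algebraMap O (integralClosure O L) b ∧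
        s ∉ (algebraMap O (integralClosure O L)).range) ↔
      ∃ y : L, y ∉ (algebraMap K L).range ∧ y ^ n = algebraMap K L (algebraMap O K b) := by
  constructor
  · rintro ⟨s, hs, hns⟩
    refine ⟨(s : L), ?_, ?_⟩
    · rintro ⟨κ, hκ⟩
      -- `κ ∈ K` is integral over `O` (its image `s` in `L` is), hence comes from `O`
      have hκint : IsIntegral O κ := by
        have h1 : IsIntegral O (s : L) := s.2
        rw [← hκ] at h1
        exact (isIntegral_algebraMap_iff (algebraMap K L).injective).mp h1
      obtain ⟨o, ho⟩ := IsIntegrallyClosed.algebraMap_eq_of_integral hκint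
      refine hns ⟨o, Subtype.ext ?_⟩
      change algebraMap O L o = (s : L)
      rw [IsScalarTower.algebraMap_apply O K L, ho, hκ]
    · have h := congrArg Subtype.val hs
      change ((s ^ n : integralClosure O L) : L) = algebraMap O L b at h
      rw [← IsScalarTower.algebraMap_apply O K L, ← h]
      simp
  · rintro ⟨y, hy, hyn⟩
    have hyint : IsIntegral O y := by
      refine IsIntegral.of_pow hn ?_
      rw [hyn, ← IsScalarTower.algebraMap_apply O K L b]
      exact isIntegral_algebraMap
    refine ⟨⟨y, hyint⟩, Subtype.ext ?_, ?_⟩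
    · change y ^ n = algebraMap O L b
      rw [hyn, IsScalarTower.algebraMap_apply O K L]
    · rintro ⟨o, ho⟩
      refine hy ⟨algebraMap O K o, ?_⟩
      have h := congrArg Subtype.val ho
      change algebraMap O L o = y at h
      rw [← IsScalarTower.algebraMap_apply O K L, h]

/-- **The regular locus of `W^L` over the regular locus of `W`, via boundary-free Giraud normal
forms.**  Let `k` be a field of characteristic `p`, `W` an integral scheme locally of finite type
over `k`, `L ⊇ K(W)` purely inseparable of degree `p`, and `x` a point of the normalization
`W^L = normalizationIn W L` lying over a regular point `w = ι x` of `W`.  Then `𝒪_{W^L,x}` is a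
regular local ring iff some `b ∈ 𝒪_{W,w}` admitting a `p`-th root `y ∈ L ∖ K(W)` (so that
`L = K(W)(y)` represents the class of `L`) is in Giraud normal form with respect to the empty
family of boundary equations.  Assembled from the stalk isomorphism
`𝒪_{W^L,x} ≅ integralClosure 𝒪_{W,w} L` (glue lemma A2), the radicial package of that integral
closure, and the abstract criterion
`RegularIffNormalFormZero.isRegularRing_iff_exists_giraudNormalFormAt_zero`. -/
theorem isRegularLocalRing_stalk_iff_exists_giraudNormalFormAt_zero : ∀ (p : ℕ) [Fact p.Prime] (k : Type) [Field k] [CharP k p] (W : Scheme.{0}) [IsIntegral W] (f : W ⟶ Spec (.of k)) [LocallyOfFiniteType f] (L : Type) [Field L] [Algebra W.functionField L] [IsPurelyInseparable W.functionField L], Module.finrank W.functionField L = p → ∀ (x : ↥(normalizationIn W L)), IsRegularLocalRing (W.presheaf.stalk ((normalizationInι W L).base x)) → (IsRegularLocalRing ((normalizationIn W L).presheaf.stalk x) ↔ ∃ b : W.presheaf.stalk ((normalizationInι W L).base x), (∃ y : L, y ∉ (algebraMap W.functionField L).range ∧ y ^ p = algebraMap W.functionField L (algebraMap (W.presheaf.stalk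 ((normalizationInι W L).base x)) W.functionField b)) ∧ GiraudNormalFormAt p (Fin.elim0 : Fin 0 → W.presheaf.stalk ((normalizationInι W L).base x)) b) := by
  intro p _ k _ _ W _ f _ L _ _ _ hdeg x hreg
  have hp : p.Prime := Fact.out
  haveI := hreg
  -- `L` as an algebra over `O = 𝒪_{W, ι x}` through `K(W)`, exactly as in the glue lemmas
  letI algOL : Algebra (W.presheaf.stalk ((normalizationInι W L).base x)) L :=
    ((algebraMap W.functionField L).comp
      (algebraMap (W.presheaf.stalk ((normalizationInι W L).base x)) W.functionField)).toAlgebra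
  haveI : IsScalarTower (W.presheaf.stalk ((normalizationInι W L).base x)) W.functionField L :=
    IsScalarTower.of_algebraMap_eq fun _ => rfl
  haveI : FiniteDimensional W.functionField L :=
    Module.finite_of_finrank_pos (by rw [hdeg]; exact hp.pos)
  haveI : Algebra.IsAlgebraic W.functionField L := Algebra.IsAlgebraic.of_finite _ L
  -- the regular local ring `O` is an integrally closed domain
  have hO : IsIntegrallyClosed (W.presheaf.stalk ((normalizationInι W L).base x)) :=
    isIntegrallyClosed_of_isRegularLocalRing _
  -- the radicial package of `S = integralClosure O L`
  obtain ⟨hchar, hfin, hfaith, hic, hrank, hrad⟩ :=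
    IntegralClosureStalk.integralClosure_stalk_radicial p k W f L hdeg
      ((normalizationInι W L).base x) hO
  haveI := hchar
  haveI := hfin
  haveI := hfaith
  haveI := hic
  -- the stalk of `W^L` at `x` is `S`
  obtain ⟨e, -⟩ :=
    StalkNormalizationIn.nonempty_stalk_normalizationIn_iso_of_isPurelyInseparable W L x hO
  -- (1) regularity of the stalk ⟺ regularity of `S`
  have h1 : IsRegularLocalRing ((normalizationIn W L).presheaf.stalk x) ↔
      IsRegularRing (integralClosure (W.presheaf.stalk ((normalizationInι W L).base x)) L) := by
    constructor
    · intro hx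
      haveI : IsRegularLocalRing
          (integralClosure (W.presheaf.stalk ((normalizationInι W L).base x)) L) :=
        IsRegularLocalRing.of_ringEquiv e.commRingCatIsoToRingEquiv
      exact isRegularRing_iff.mpr fun q _ => isRegularLocalRing_localization_atPrime _ q
    · intro hS
      haveI := hS
      haveI : IsLocalRing
          (integralClosure (W.presheaf.stalk ((normalizationInι W L).base x)) L) :=
        e.commRingCatIsoToRingEquiv.isLocalRing
      haveI : IsRegularLocalRing
          (integralClosure (W.presheaf.stalk ((normalizationInι W L).base x)) L) :=
        IsRegularLocalRing.of_isRegularRing_of_isLocalRing _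
      exact IsRegularLocalRing.of_ringEquiv e.commRingCatIsoToRingEquiv.symm
  -- (2) the abstract criterion for `S` over `O`
  rw [h1, RegularIffNormalFormZero.isRegularRing_iff_exists_giraudNormalFormAt_zero hrank hrad]
  -- (3) roots in `S ∖ O` are roots in `L ∖ K(W)`
  constructor
  · rintro ⟨h, s, hs, hns, hg⟩
    exact ⟨h, (exists_root_integralClosure_iff hp.pos h).mp ⟨s, hs, hns⟩, hg⟩
  · rintro ⟨b, hy, hg⟩
    obtain ⟨s, hs, hns⟩ := (exists_root_integralClosure_iff hp.pos b).mpr hy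
    exact ⟨b, s, hs, hns, hg⟩

end Summit.ResolutionOfSingularities.ResolutionOfSingularities.Theorems.Picover.RegularLocusNormalForm

end
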